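import Literature.AlgebraicGeometry.Deformation.T1Lifting
import Mathlib.Algebra.Polynomial.Degree.TrailingDegree
import Mathlib.RingTheory.MvPowerSeries.Basic
import Mathlib.RingTheory.Ideal.Quotient.Operations
import HarnessLib

/-!
# [FM98] Example 5.7 (iii): over `k = ℝ`, the morphism `h_S → h_R` for `R = k[[x, y]]/(x² + y²) → S = k[[x, y]]/(x², y²)` «has no curvilinear obstructions»

[FantechiManetti1998ObstructionCalculus] = B. Fantechi, M. Manetti, «Obstruction calculus for functors of Artin
rings, I», J. Algebra 202 (1998) 541–576, p. 562 (held publisher text layer, store `paper:doi-10-1006-jabr-1997-7239`,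
p0022 L9–11, L46–47):

«EXAMPLE 5.7. … (iii) Let `k = ℝ`, `R = k[[x, y]]/(x² + y²)`, `S = k[[x, y]]/(x², y²)`, and `R → S` be the natural
projection. Then the morphism `h_S → h_R` has no curvilinear obstructions.» — and, after PROPOSITION 5.8 («Let `k`
be an algebraically closed field, and let `S → R` be a morphism in `Ârt_k`. Assume that `h_R → h_S` has no relative
curvilinear obstructions. Then `S_red → R_red` is smooth, and `dim R − dim S = dim t_R − dim t_S`.»): «Note also
that if `k` is not algebraically closed then Proposition 5.8 may fail, cf. Example 5.7 (iii).»

What is typed here, for ANY linearly ordered field `k` (print: `k = ℝ`; theorems only — `A_N = k[t]/(t^(N+1))`,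
`i : A_(N+1) → A_N` and `Art_k` are those of `T1Lifting.lean`, `h_R(A) =` all `k`-algebra maps `R → A`, and the two
rings are the quotients of `P = k[[x, y]]` = `MvPowerSeries (Fin 2) k` by the inline ideals `(x² + y²) ⊆ (x², y²)`):
* the computation behind (iii) (printed without proof; supplied): a sum of two squares VANISHING in
  `A_N = k[t]/(t^(N+1))` has both squares vanishing — in `k[t]`, `t^m ∣ p² + q² ⇒ t^m ∣ p²`, because over an ordered
  field the lowest coefficients of `p²` and `q²` are positive squares and cannot cancel
  (`T1Lifting.X_pow_dvd_sq_of_X_pow_dvd_sq_add_sq`, `T1Lifting.sq_eq_zero_of_sq_add_sq_eq_zero`); hence EVERY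
  `k`-algebra map `R → A_N` kills `x²` and `y²` (`FM98Example57iii.map_sq_eq_zero`), i.e. every curve of `R` factors
  through `S`: `h_S(A_N) → h_R(A_N)` is a bijection for every `N` (`FM98Example57iii.points_comp_bijective`);
* consequently the RELATIVE CURVILINEAR LIFTING property of `h_S → h_R`:
  `h_S(A_(N+1)) → h_S(A_N) ×_{h_R(A_N)} h_R(A_(N+1))` onto for every `N`
  (`FM98Example57iii.relative_curvilinear_lifting`) — which is «no relative curvilinear obstructions» by the
  paper's own statements exactly as for (ii) in the sibling tree file `RelativeCurvilinearLiftingNotSmooth.lean`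
  (Def. 3.5 p. 552 = p0012 L5–7 — for a MORPHISM `ν : F → G`: «An element in `O_ν` is said to be a curvilinear
  obstruction if it is in the image of `ob_e` for some curvilinear extension `e`», so print's «no curvilinear
  obstructions» for the morphism `h_S → h_R` is the relative notion; curvilinear extensions p. 545; Prop. 3.3 p. 551 =
  p0011 L5–10; Def. 4.1 p. 552 = p0012 L71–73; Cor. 4.13 p. 559 = p0019 L8–9: the universal relative theory of a
  morphism of left-exact functors is complete); the obstruction spaces themselves are
  not typed here, nor is Proposition 5.8 or its failure («`dim R − dim S ≠ dim t_R − dim t_S`» would need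
  `dim k[[x, y]]/(x² + y²) = 1`).
WHY `k` ORDERED (print: `k = ℝ`): over `k = ℂ` the map `x ↦ t, y ↦ it` is a curve of `R` not factoring through `S`.
No obstruction theory, no `Λ`-algebra structure and no geometric object is instantiated; (i) and (ii) of the same
Example are the tree files `CurvilinearObstructionsDoNotGenerate.lean` (proposed) and `RelativeCurvilinearLiftingNotSmooth.lean`.

## References

* B. Fantechi, M. Manetti, *Obstruction calculus for functors of Artin rings, I*, J. Algebra 202 (1998) 541–576:
  §1 p. 545 (curvilinear extensions), Def. 3.5, Prop. 3.3, Def. 4.1, Cor. 4.13, Example 5.7 (iii), Prop. 5.8 and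
  the note after it (p. 562). [FantechiManetti1998ObstructionCalculus]
-/

open Polynomial

namespace Literature.AlgebraicGeometry.Deformation

universe u
variable (k : Type u) [Field k]

namespace T1Lifting

variable [LinearOrder k] [IsStrictOrderedRing k]

/-- Over an ORDERED field a sum of two squares has no cancellation in its lowest term: if `t^m` divides `p² + q²`
in `k[t]` then `t^m` divides `p²` (the coefficient of `p² + q²` in degree `min(ord p², ord q²)` is a sum of a
nonzero square and a square, hence positive, so `ord(p² + q²) ≤ ord p²`).
[cite: FantechiManetti1998ObstructionCalculus, Ex. 5.7 (iii)] -/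
theorem X_pow_dvd_sq_of_X_pow_dvd_sq_add_sq {m : ℕ} {p q : k[X]} (h : (X : k[X]) ^ m ∣ p ^ 2 + q ^ 2) :
    (X : k[X]) ^ m ∣ p ^ 2 := by
  by_cases hp0 : p = 0
  · subst hp0; simp
  have hp2 : p ^ 2 ≠ 0 := pow_ne_zero 2 hp0
  -- it suffices that `m ≤ ord(p²)`
  suffices hm : m ≤ (p ^ 2).natTrailingDegree from
    X_pow_dvd_iff.2 fun d hd => coeff_eq_zero_of_lt_natTrailingDegree (lt_of_lt_of_le hd hm)
  -- the trailing coefficient of a nonzero square is positive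
  have htc : ∀ r : k[X], r ≠ 0 → 0 < (r ^ 2).coeff (r ^ 2).natTrailingDegree := fun r hr => by
    change 0 < (r ^ 2).trailingCoeff
    rw [pow_two, trailingCoeff_mul]
    exact mul_self_pos.2 (trailingCoeff_nonzero_iff_nonzero.2 hr)
  by_cases hq0 : q = 0
  · subst hq0
    rw [zero_pow two_ne_zero, add_zero] at h
    exact le_natTrailingDegree hp2 (X_pow_dvd_iff.1 h)
  -- the coefficient of `p² + q²` in degree `min(ord p², ord q²)` is positive
  have hpos : 0 < (p ^ 2 + q ^ 2).coeff (min (p ^ 2).natTrailingDegree (q ^ 2).natTrailingDegree) := by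
    rw [coeff_add]
    rcases lt_trichotomy (p ^ 2).natTrailingDegree (q ^ 2).natTrailingDegree with hlt | heq | hgt
    · rw [min_eq_left hlt.le, coeff_eq_zero_of_lt_natTrailingDegree (p := q ^ 2) hlt, add_zero]
      exact htc p hp0
    · have hp' := htc p hp0
      rw [heq] at hp' ⊢
      rw [min_self]
      exact add_pos hp' (htc q hq0)
    · rw [min_eq_right hgt.le, coeff_eq_zero_of_lt_natTrailingDegree (p := p ^ 2) hgt, zero_add]
      exact htc q hq0
  have hS : p ^ 2 + q ^ 2 ≠ 0 := fun h0 => hpos.ne' (by rw [h0, coeff_zero])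
  have h1 : m ≤ (p ^ 2 + q ^ 2).natTrailingDegree := le_natTrailingDegree hS (X_pow_dvd_iff.1 h)
  have h2 : (p ^ 2 + q ^ 2).natTrailingDegree ≤ min (p ^ 2).natTrailingDegree (q ^ 2).natTrailingDegree :=
    natTrailingDegree_le_of_ne_zero hpos.ne'
  exact h1.trans (h2.trans (min_le_left _ _))

/-- In the curvilinear algebra `A_N = k[t]/(t^(N+1))` over an ordered field: `u² + v² = 0 ⇒ u² = 0`.
[cite: FantechiManetti1998ObstructionCalculus, Ex. 5.7 (iii)] -/
theorem sq_eq_zero_of_sq_add_sq_eq_zero (N : ℕ) {u v : A k N} (h : u ^ 2 + v ^ 2 = 0) : u ^ 2 = 0 := by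
  obtain ⟨p, rfl⟩ := AdjoinRoot.mk_surjective u
  obtain ⟨q, rfl⟩ := AdjoinRoot.mk_surjective v
  rw [← map_pow, ← map_pow, ← map_add, AdjoinRoot.mk_eq_zero] at h
  rw [← map_pow, AdjoinRoot.mk_eq_zero]
  exact X_pow_dvd_sq_of_X_pow_dvd_sq_add_sq k h

end T1Lifting

namespace FM98Example57iii

open MvPowerSeries

/-- The inclusion of ideals `(x² + y²) ⊆ (x², y²)` of `k[[x, y]]` behind «`R → S` the natural projection» of
[FM98] Example 5.7 (iii). [cite: FantechiManetti1998ObstructionCalculus, Ex. 5.7 (iii)] -/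
theorem span_le :
    Ideal.span {(X 0 : MvPowerSeries (Fin 2) k) ^ 2 + X 1 ^ 2} ≤
      Ideal.span {(X 0 : MvPowerSeries (Fin 2) k) ^ 2, X 1 ^ 2} := by
  rw [Ideal.span_le, Set.singleton_subset_iff]
  exact add_mem (Ideal.subset_span (by simp)) (Ideal.subset_span (by simp))

variable [LinearOrder k] [IsStrictOrderedRing k]

/-- [FM98] Example 5.7 (iii), the computation (printed without proof; supplied here): over an ordered field, with
`R = k[[x, y]]/(x² + y²)`, EVERY `k`-algebra map `R → A_N` (every curvilinear point of `R`) kills `x²` and `y²` —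
its values `u, v` on `x, y` satisfy `u² + v² = 0`, and squares do not cancel.
[cite: FantechiManetti1998ObstructionCalculus, Ex. 5.7 (iii)] -/
theorem map_sq_eq_zero (N : ℕ)
    (φ : (MvPowerSeries (Fin 2) k ⧸ Ideal.span {(X 0 : MvPowerSeries (Fin 2) k) ^ 2 + X 1 ^ 2}) →ₐ[k]
      T1Lifting.A k N) (s : Fin 2) :
    φ (Ideal.Quotient.mk _ (X s ^ 2)) = 0 := by
  have h0 : Ideal.Quotient.mk (Ideal.span {(X 0 : MvPowerSeries (Fin 2) k) ^ 2 + X 1 ^ 2})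
      ((X 0 : MvPowerSeries (Fin 2) k) ^ 2 + X 1 ^ 2) = 0 :=
    Ideal.Quotient.eq_zero_iff_mem.2 (Ideal.subset_span (Set.mem_singleton _))
  have h := congrArg φ h0
  simp only [map_zero, map_add, map_pow] at h
  have hx := T1Lifting.sq_eq_zero_of_sq_add_sq_eq_zero k N h
  have hy := T1Lifting.sq_eq_zero_of_sq_add_sq_eq_zero k N (by rwa [add_comm] at h)
  revert s
  rw [Fin.forall_fin_two, map_pow, map_pow, map_pow, map_pow]
  exact ⟨hx, hy⟩

/-- [FM98] Example 5.7 (iii) for the functors of points: with `R = k[[x, y]]/(x² + y²)`, `S = k[[x, y]]/(x², y²)`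
(`k` ordered) and `π : R → S` the natural projection, composition with `π` is a BIJECTION `h_S(A_N) → h_R(A_N)` for
every `N` — every curvilinear point of `R` factors (uniquely) through `S`.
[cite: FantechiManetti1998ObstructionCalculus, Ex. 5.7 (iii)] -/
theorem points_comp_bijective (N : ℕ) :
    Function.Bijective fun ψ : (MvPowerSeries (Fin 2) k ⧸ Ideal.span {(X 0 : MvPowerSeries (Fin 2) k) ^ 2,
        X 1 ^ 2}) →ₐ[k] T1Lifting.A k N =>
      ψ.comp (Ideal.Quotient.factorₐ k (span_le k)) := by
  set I : Ideal (MvPowerSeries (Fin 2) k) :=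
    Ideal.span {(X 0 : MvPowerSeries (Fin 2) k) ^ 2 + X 1 ^ 2} with hI
  set J : Ideal (MvPowerSeries (Fin 2) k) := Ideal.span {(X 0 : MvPowerSeries (Fin 2) k) ^ 2, X 1 ^ 2} with hJ
  have hππ : (Ideal.Quotient.factorₐ k (span_le k)).comp (Ideal.Quotient.mkₐ k I) =
      Ideal.Quotient.mkₐ k J := Ideal.Quotient.factorₐ_comp_mk k (span_le k)
  constructor
  · intro ψ₁ ψ₂ h
    apply Ideal.Quotient.algHom_ext
    simp only at h
    rw [← hππ, ← AlgHom.comp_assoc, h, AlgHom.comp_assoc]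
  · intro φ
    have hker : ∀ a ∈ J, φ.comp (Ideal.Quotient.mkₐ k I) a = 0 := by
      intro a ha
      have hsub : ({(X 0 : MvPowerSeries (Fin 2) k) ^ 2, X 1 ^ 2} : Set _) ⊆
          RingHom.ker (φ.comp (Ideal.Quotient.mkₐ k I)) := by
        intro b hb
        simp only [Set.mem_insert_iff, Set.mem_singleton_iff] at hb
        rw [SetLike.mem_coe, RingHom.mem_ker]
        rcases hb with rfl | rfl
        · rw [AlgHom.coe_comp, Function.comp_apply, Ideal.Quotient.mkₐ_eq_mk]
          exact map_sq_eq_zero k N φ 0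
        · rw [AlgHom.coe_comp, Function.comp_apply, Ideal.Quotient.mkₐ_eq_mk]
          exact map_sq_eq_zero k N φ 1
      exact (RingHom.mem_ker).1 (Ideal.span_le.2 hsub ha)
    refine ⟨Ideal.Quotient.liftₐ J (φ.comp (Ideal.Quotient.mkₐ k I)) hker, ?_⟩
    apply Ideal.Quotient.algHom_ext
    simp only
    rw [AlgHom.comp_assoc, hππ, Ideal.Quotient.liftₐ_comp]

/-- **[FantechiManetti1998ObstructionCalculus, EXAMPLE 5.7 (iii)]** «Let `k = ℝ`, `R = k[[x, y]]/(x² + y²)`,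
`S = k[[x, y]]/(x², y²)`, and `R → S` be the natural projection. Then the morphism `h_S → h_R` has no curvilinear
obstructions.» — typed, for any ordered field `k`, as the RELATIVE CURVILINEAR LIFTING property of `h_S → h_R`
(= «no relative curvilinear obstructions» by Def. 3.5, Prop. 3.3, Def. 4.1 and Cor. 4.13 of the same paper, the
functors of points being left-exact — as for (ii) in `RelativeCurvilinearLiftingNotSmooth.lean`): for every `N`,
every point `a ∈ h_S(A_N)` and every curvilinear extension `b ∈ h_R(A_(N+1))` of its image (`i ∘ b = a ∘ π`,
`i : A_(N+1) → A_N`) there is `b' ∈ h_S(A_(N+1))` over both (`i ∘ b' = a`, `b' ∘ π = b`). (After Prop. 5.8, p. 562: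
«Note also that if `k` is not algebraically closed then Proposition 5.8 may fail, cf. Example 5.7 (iii)» — Prop. 5.8
and this failure are not typed.) [cite: FantechiManetti1998ObstructionCalculus, Ex. 5.7 (iii)] -/
theorem relative_curvilinear_lifting (N : ℕ)
    (a : (MvPowerSeries (Fin 2) k ⧸ Ideal.span {(X 0 : MvPowerSeries (Fin 2) k) ^ 2, X 1 ^ 2}) →ₐ[k]
      T1Lifting.A k N)
    (b : (MvPowerSeries (Fin 2) k ⧸ Ideal.span {(X 0 : MvPowerSeries (Fin 2) k) ^ 2 + X 1 ^ 2}) →ₐ[k]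
      T1Lifting.A k (N + 1))
    (hab : (T1Lifting.i k N).comp b = a.comp (Ideal.Quotient.factorₐ k (span_le k))) :
    ∃ b' : (MvPowerSeries (Fin 2) k ⧸ Ideal.span {(X 0 : MvPowerSeries (Fin 2) k) ^ 2, X 1 ^ 2}) →ₐ[k]
        T1Lifting.A k (N + 1),
      (T1Lifting.i k N).comp b' = a ∧ b'.comp (Ideal.Quotient.factorₐ k (span_le k)) = b := by
  obtain ⟨b', hb'⟩ := (points_comp_bijective k (N + 1)).2 b
  refine ⟨b', (points_comp_bijective k N).1 ?_, hb'⟩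
  simp only at hb' ⊢
  rw [AlgHom.comp_assoc, hb', hab]

end FM98Example57iii

end Literature.AlgebraicGeometry.Deformation
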